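import Literature.AlgebraicGeometry.Motives.HodgeThetaSubalgebraUnitaryThreeCoprimeCore
import HarnessLib

/-!
# `ad(End V)`-stable subspaces of `End(V)`: a non-scalar element forces all trace-zero operators
# (the ideal structure of `𝔤𝔩(V)`; input of the double-Levi argument for Ribet 1983 Thm. 3, Lie step)

Family `hodge`, layer `Literature/AlgebraicGeometry/Motives` (pure linear algebra over `ℂ`; no geometry). Research
context: cell `pub-hodge-ring2` (HONEST FRAMING: research route conditional on HC_CM; not a corollary; Q11.4-sentence-2
already refuted in dim ≥ 3), Literature lane gen 85, programme R70 («double Levi»: the `(8 | 9)` stall of the unitary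
`Θ`-subalgebra ladder). UNCONDITIONAL; theorems only, no definition, no named fact (D-0026), no `sorry`.

THE STATEMENT (classical: the `ad`-invariant subspaces of `𝔤𝔩_n` are `0`, the scalars, `𝔰𝔩_n`, `𝔤𝔩_n`
[Humphreys1972, §19.1 with §4.1]; here in the operational form the unitary cores need, extending the tree's
`UnitaryTwoOdd.exists_rankOne_of_adStable`). Let `𝔑 ⊆ End(V)` be a subspace with `[A, Y] ∈ 𝔑` for all `A ∈ End(V)`,
`Y ∈ 𝔑` («`ad`-stable»), `dim V ≥ 3`, containing an operator `N` and a vector `w` with `N w ∉ ℂw` (i.e. `N` is not a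
scalar, §0). Then:
* §1 **`UnitaryAdStable.smulRight_mem`** — `𝔑` contains every rank-one operator `u ⊗ α` (`w ↦ α(w)u`) with `α(u) = 0`.
  (With `e = w ⊗ φ'`, `φ'(w) = 1`: `[[N,e],e] + [N,e] = 2·(Nw − φ'(Nw)w) ⊗ φ'` is such an operator `u₀ ⊗ φ'` with
  `u₀ ≠ 0`, `φ'(u₀) = 0`; then `[z ⊗ γ, u₀ ⊗ φ'] = γ(u₀) z ⊗ φ' − φ'(z) u₀ ⊗ γ` gives `z ⊗ φ'` for `z ∈ ker φ'`, then
  `z ⊗ γ` for `γ(z) = 0`, and finally `u ⊗ α = [u ⊗ β, z ⊗ α]` for `z ∈ ker φ' ∩ ker α ∖ 0`, `β(z) = 1` — such `z` exists as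
  `dim V ≥ 3`.)
* §2 **`UnitaryAdStable.mem_of_trace_eq_zero`** — `𝔑` contains every operator of trace `0` (matrix units along a basis:
  `E_{ij}`, `i ≠ j`, and `E_{ii} − E_{00} = (b_i + b_0) ⊗ (b_i^* − b_0^*) + E_{i0} − E_{0i}` are of the form of §1, and
  `T = Σ c_{ij} E_{ij} = Σ c_{ij}(E_{ij} − δ_{ij}E_{00}) + tr(T)·E_{00}`).
* §3 **`UnitaryAdStable.eq_top_of_trace_ne_zero`** — if moreover some `A₀ ∈ 𝔑` has `tr A₀ ≠ 0` then `𝔑 = End(V)`;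
  **`UnitaryAdStable.exists_rankOne_idempotent`** — then `𝔑` contains a rank-one idempotent.
* §0 helpers: `UnitaryAdStable.exists_apply_not_mem_span` (an operator all of whose vectors are eigenvectors is a
  scalar), `UnitaryAdStable.exists_not_scalar_of_two_le_finrank` (a subspace of `End(V)` of dimension `≥ 2` contains a
  non-scalar operator).

USE (sequel files of programme R70). For a self-adjoint involution `ι ∈ 𝔊` commuting with `Θ` whose Levi algebra on
`U⁻ = {ι = −1}` is full, the restrictions to `U⁻` of the elements of `𝔊` killing `U⁺` form such an `𝔑` («Levi kernel
ideal»); §1 then produces a rank-one raising operator in `𝔊`, and §3 a rank-one idempotent — the two halves of the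
double-Levi argument replacing Serre's minuscule-weight lemma at the `(8 | 9)` stall of [Ribet1983, Thm. 3].

## References
* [Humphreys1972] J. E. Humphreys, *Introduction to Lie Algebras and Representation Theory* (1972), §19.1 (ideals of
  `𝔤𝔩(n, F)`), §4.1.
* [HoffmanKunze1971LinearAlgebra] K. Hoffman, R. Kunze, *Linear Algebra* (1971), §3.5 (matrix of a linear map, matrix
  units), §3.6 (linear functionals, dual basis), §6.2.
* [Ribet1983] K. A. Ribet, Amer. J. Math. 105 (1983), Thm. 3 (= [Gordon1997, Thm. 6.3 (3)], pp. 18–19).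
-/

noncomputable section

open Module

namespace Literature.AlgebraicGeometry.Motives

namespace HodgeStructure

variable {V : Type*} [AddCommGroup V] [Module ℂ V]

/-! ### §0 Non-scalar operators -/

/-- Two vectors `u ≠ 0`, `v ∉ ℂu` are linearly independent: `αu + βv = 0 ⟹ α = β = 0`.
[cite: HoffmanKunze1971LinearAlgebra, §2.3] -/
theorem UnitaryAdStable.eq_zero_of_pair {u v : V} (hu : u ≠ 0) (hv : v ∉ ℂ ∙ u) {α β : ℂ}
    (h : α • u + β • v = 0) : α = 0 ∧ β = 0 := by
  have hβ : β = 0 := by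
    by_contra hβ
    apply hv
    rw [Submodule.mem_span_singleton]
    refine ⟨-(β⁻¹ * α), ?_⟩
    have h' : β • v = -(α • u) := eq_neg_of_add_eq_zero_right h
    calc -(β⁻¹ * α) • u = β⁻¹ • (-(α • u)) := by rw [neg_smul, mul_smul, smul_neg]
      _ = v := by rw [← h', smul_smul, inv_mul_cancel₀ hβ, one_smul]
  refine ⟨?_, hβ⟩
  rw [hβ, zero_smul, add_zero] at h
  exact (smul_eq_zero.1 h).resolve_right hu

/-- Coefficient comparison along two independent vectors. [cite: HoffmanKunze1971LinearAlgebra, §2.3] -/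
theorem UnitaryAdStable.coeff_eq_of_pair {u v : V} (hu : u ≠ 0) (hv : v ∉ ℂ ∙ u) {α β α' β' : ℂ}
    (h : α • u + β • v = α' • u + β' • v) : α = α' ∧ β = β' := by
  have h' : (α - α') • u + (β - β') • v = 0 := by
    rw [sub_smul, sub_smul]
    have := sub_eq_zero.2 h
    calc α • u - α' • u + (β • v - β' • v) = α • u + β • v - (α' • u + β' • v) := by abel
      _ = 0 := this
  obtain ⟨h1, h2⟩ := UnitaryAdStable.eq_zero_of_pair hu hv h'
  exact ⟨sub_eq_zero.1 h1, sub_eq_zero.1 h2⟩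

/-- **An operator all of whose vectors are eigenvectors is a scalar**; contrapositively, a non-scalar `N` moves some
`w` off its line. [cite: HoffmanKunze1971LinearAlgebra, §6.2] -/
theorem UnitaryAdStable.exists_apply_not_mem_span (N : Module.End ℂ V) (hN : ∀ c : ℂ, N ≠ c • 1) :
    ∃ w : V, N w ∉ ℂ ∙ w := by
  by_contra hne
  push Not at hne
  -- `V ≠ 0`
  have hV : ∃ u : V, u ≠ 0 := by
    by_contra h0
    push Not at h0
    exact hN 0 (LinearMap.ext fun v => by rw [h0 v, map_zero, map_zero])
  obtain ⟨u, hu⟩ := hV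
  obtain ⟨c, hc⟩ := Submodule.mem_span_singleton.1 (hne u)
  apply hN c
  refine LinearMap.ext fun v => ?_
  rw [LinearMap.smul_apply, Module.End.one_apply]
  by_cases hv : v ∈ ℂ ∙ u
  · obtain ⟨a, rfl⟩ := Submodule.mem_span_singleton.1 hv
    rw [map_smul, ← hc, smul_comm]
  · obtain ⟨d, hd⟩ := Submodule.mem_span_singleton.1 (hne v)
    obtain ⟨e, he⟩ := Submodule.mem_span_singleton.1 (hne (u + v))
    rw [map_add, ← hc, ← hd, smul_add] at he
    obtain ⟨h1, h2⟩ := UnitaryAdStable.coeff_eq_of_pair hu hv he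
    rw [← hd, ← h2, h1]

/-- A subspace of `End(V)` of dimension `≥ 2` contains a non-scalar operator. [cite: HoffmanKunze1971LinearAlgebra, §2.3] -/
theorem UnitaryAdStable.exists_not_scalar_of_two_le_finrank [FiniteDimensional ℂ V]
    (𝔑 : Submodule ℂ (Module.End ℂ V)) (h2 : 2 ≤ Module.finrank ℂ 𝔑) :
    ∃ N ∈ 𝔑, ∀ c : ℂ, N ≠ c • 1 := by
  by_contra hne
  push Not at hne
  have hle : 𝔑 ≤ ℂ ∙ (1 : Module.End ℂ V) := by
    intro N hN
    obtain ⟨c, hc⟩ := hne N hN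
    exact Submodule.mem_span_singleton.2 ⟨c, hc.symm⟩
  have h1 : Module.finrank ℂ (ℂ ∙ (1 : Module.End ℂ V)) ≤ 1 := (finrank_span_le_card _).trans (by simp)
  have := Submodule.finrank_mono hle
  omega

/-! ### §1 Rank-one operators `u ⊗ α` with `α(u) = 0` -/

/-- **An `ad(End V)`-stable subspace containing a non-scalar operator contains every `u ⊗ α` with `α(u) = 0`**
(`dim V ≥ 3`). See the module docstring for the bracket computations. [cite: Humphreys1972, §19.1]
[cite: HoffmanKunze1971LinearAlgebra, §3.6] -/
theorem UnitaryAdStable.smulRight_mem [FiniteDimensional ℂ V] (𝔑 : Submodule ℂ (Module.End ℂ V))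
    (had : ∀ A : Module.End ℂ V, ∀ Y ∈ 𝔑, A * Y - Y * A ∈ 𝔑) {N : Module.End ℂ V} (hN : N ∈ 𝔑) {w : V}
    (hw : N w ∉ ℂ ∙ w) (h3 : 3 ≤ Module.finrank ℂ V) :
    ∀ (u : V) (α : Module.Dual ℂ V), α u = 0 → α.smulRight u ∈ 𝔑 := by
  classical
  have hw0 : w ≠ 0 := fun h => hw (by rw [h, map_zero]; exact Submodule.zero_mem _)
  obtain ⟨φ', hφ'w⟩ := Module.Projective.exists_dual_eq_one ℂ hw0
  set u₀ : V := N w - φ' (N w) • w with hu₀def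
  have hu₀ : u₀ ≠ 0 := fun h => hw (Submodule.mem_span_singleton.2 ⟨φ' (N w), (sub_eq_zero.1 h).symm⟩)
  have hφ'u₀ : φ' u₀ = 0 := by rw [hu₀def, map_sub, map_smul, hφ'w, smul_eq_mul, mul_one, sub_self]
  -- Step 0: `u₀ ⊗ φ' ∈ 𝔑`
  set e : Module.End ℂ V := φ'.smulRight w with hedef
  have h1 : e * N - N * e ∈ 𝔑 := had e N hN
  have h2 : e * (e * N - N * e) - (e * N - N * e) * e ∈ 𝔑 := had e _ h1
  have hkey : e * (e * N - N * e) - (e * N - N * e) * e - (e * N - N * e) = (2 : ℂ) • φ'.smulRight u₀ := by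
    have heN : e * N = (φ' ∘ₗ N).smulRight w := UnitaryTwoOdd.smulRight_mul N φ' w
    have hNe : N * e = φ'.smulRight (N w) := UnitaryTwoOdd.mul_smulRight N φ' w
    refine LinearMap.ext fun v => ?_
    simp only [LinearMap.sub_apply, Module.End.mul_apply, LinearMap.smul_apply, hedef, LinearMap.smulRight_apply,
      map_smul, map_sub, hφ'w, hu₀def, smul_sub, smul_smul]
    module
  have hn₀ : φ'.smulRight u₀ ∈ 𝔑 := by
    have h := Submodule.sub_mem _ h2 h1
    rw [hkey] at h
    exact (Submodule.smul_mem_iff _ (two_ne_zero (α := ℂ))).1 h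
  -- Step 1: `z ⊗ φ' ∈ 𝔑` for `φ'(z) = 0`
  obtain ⟨γ₀, hγ₀⟩ := Module.Projective.exists_dual_eq_one ℂ hu₀
  have hA : ∀ z, φ' z = 0 → φ'.smulRight z ∈ 𝔑 := fun z hz => by
    have h := had (γ₀.smulRight z) _ hn₀
    rwa [UnitaryTwoOdd.smulRight_comm_smulRight, hγ₀, one_smul, hz, zero_smul, sub_zero] at h
  -- Step 2: `z ⊗ γ ∈ 𝔑` for `φ'(z) = 0`, `γ(z) = 0`
  have hB : ∀ z (γ : Module.Dual ℂ V), φ' z = 0 → γ z = 0 → γ.smulRight z ∈ 𝔑 := fun z γ hz hγz => by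
    have h := had (γ.smulRight w) _ (hA z hz)
    rw [UnitaryTwoOdd.smulRight_comm_smulRight, hγz, zero_smul, hφ'w, one_smul, zero_sub] at h
    exact (Submodule.neg_mem_iff _).1 h
  -- Step 3: a non-zero `z ∈ ker φ' ∩ ker α`, then `u ⊗ α = [u ⊗ β, z ⊗ α]`
  intro u α hαu
  set L : V →ₗ[ℂ] ℂ × ℂ := LinearMap.prod φ' α with hLdef
  have hker : 0 < Module.finrank ℂ (LinearMap.ker L) := by
    have h := LinearMap.finrank_range_add_finrank_ker L
    have hr : Module.finrank ℂ (LinearMap.range L) ≤ 2 := by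
      have := Submodule.finrank_le (LinearMap.range L)
      rw [Module.finrank_prod, Module.finrank_self] at this
      exact this
    omega
  obtain ⟨⟨z, hzL⟩, hz0⟩ := Module.finrank_pos_iff_exists_ne_zero.1 hker
  have hz0' : z ≠ 0 := fun h => hz0 (Subtype.ext h)
  have hzφα : φ' z = 0 ∧ α z = 0 := by
    rw [LinearMap.mem_ker, hLdef, LinearMap.prod_apply, Prod.ext_iff] at hzL
    exact hzL
  obtain ⟨β, hβz⟩ := Module.Projective.exists_dual_eq_one ℂ hz0'
  have h := had (β.smulRight u) _ (hB z α hzφα.1 hzφα.2)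
  rwa [UnitaryTwoOdd.smulRight_comm_smulRight, hβz, one_smul, hαu, zero_smul, sub_zero] at h

/-! ### §2 Trace-zero operators -/

/-- The trace of `T` is the sum of the diagonal coordinates `b_i^*(T b_i)` along any finite basis.
[cite: HoffmanKunze1971LinearAlgebra, §3.5] -/
theorem UnitaryAdStable.trace_eq_sum_coord [FiniteDimensional ℂ V] {n : ℕ} (b : Basis (Fin n) ℂ V)
    (T : Module.End ℂ V) : LinearMap.trace ℂ V T = ∑ i, b.coord i (T (b i)) := by
  rw [LinearMap.trace_eq_matrix_trace ℂ b T, Matrix.trace]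
  refine Finset.sum_congr rfl fun i _ => ?_
  rw [Matrix.diag_apply, LinearMap.toMatrix_apply, Basis.coord_apply]

/-- Expansion of an operator in the matrix units `E_{ij} = b_i ⊗ b_j^*` of a basis: `T = Σ_{i,j} b_i^*(T b_j)·E_{ij}`.
[cite: HoffmanKunze1971LinearAlgebra, §3.5] -/
theorem UnitaryAdStable.eq_sum_matrixUnits {n : ℕ} (b : Basis (Fin n) ℂ V) (T : Module.End ℂ V) :
    T = ∑ i, ∑ j, b.coord i (T (b j)) • (b.coord j).smulRight (b i) := by
  classical
  refine b.ext fun k => ?_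
  simp only [LinearMap.coe_sum, Finset.sum_apply, LinearMap.smul_apply, LinearMap.smulRight_apply, Basis.coord_apply,
    Basis.repr_self, Finsupp.single_apply]
  have hinner : ∀ i : Fin n, (∑ j, b.repr (T (b j)) i • ((if k = j then (1 : ℂ) else 0) • b i)) =
      b.repr (T (b k)) i • b i := fun i => by
    rw [Finset.sum_eq_single k]
    · rw [if_pos rfl, one_smul]
    · intro j _ hj; rw [if_neg (Ne.symm hj), zero_smul, smul_zero]
    · intro h; exact absurd (Finset.mem_univ k) h
  simp only [hinner]
  exact (b.sum_repr (T (b k))).symm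

/-- **An `ad(End V)`-stable subspace containing a non-scalar operator contains every trace-zero operator**
(`dim V ≥ 3`): the `𝔰𝔩(V)` half of the ideal structure of `𝔤𝔩(V)`. [cite: Humphreys1972, §19.1]
[cite: HoffmanKunze1971LinearAlgebra, §3.5] -/
theorem UnitaryAdStable.mem_of_trace_eq_zero [FiniteDimensional ℂ V] (𝔑 : Submodule ℂ (Module.End ℂ V))
    (had : ∀ A : Module.End ℂ V, ∀ Y ∈ 𝔑, A * Y - Y * A ∈ 𝔑) {N : Module.End ℂ V} (hN : N ∈ 𝔑) {w : V}
    (hw : N w ∉ ℂ ∙ w) (h3 : 3 ≤ Module.finrank ℂ V) :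
    ∀ T : Module.End ℂ V, LinearMap.trace ℂ V T = 0 → T ∈ 𝔑 := by
  classical
  intro T hT
  have hnil := UnitaryAdStable.smulRight_mem 𝔑 had hN hw h3
  set n := Module.finrank ℂ V with hndef
  set b : Basis (Fin n) ℂ V := Module.finBasis ℂ V with hbdef
  have hn : 0 < n := by omega
  set i₀ : Fin n := ⟨0, hn⟩ with hi₀def
  set E : Fin n → Fin n → Module.End ℂ V := fun i j => (b.coord j).smulRight (b i) with hEdef
  have hcoord : ∀ i j : Fin n, b.coord j (b i) = if j = i then 1 else 0 := fun i j => by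
    rw [Basis.coord_apply, Basis.repr_self, Finsupp.single_apply]
    simp only [eq_comm]
  -- off-diagonal units
  have hoff : ∀ i j, i ≠ j → E i j ∈ 𝔑 := fun i j hij => hnil (b i) (b.coord j) (by rw [hcoord, if_neg (Ne.symm hij)])
  -- `E_{ii} − E_{00}`
  have hdiag : ∀ i, E i i - E i₀ i₀ ∈ 𝔑 := fun i => by
    by_cases hi : i = i₀
    · rw [hi, sub_self]; exact Submodule.zero_mem _
    have hX : (b.coord i - b.coord i₀).smulRight (b i + b i₀) ∈ 𝔑 := hnil _ _ (by
      rw [LinearMap.sub_apply, map_add, map_add, hcoord, hcoord, hcoord, hcoord, if_pos rfl, if_neg (Ne.symm hi),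
        if_neg hi, if_pos rfl]; ring)
    have heq : E i i - E i₀ i₀ = (b.coord i - b.coord i₀).smulRight (b i + b i₀) + E i i₀ - E i₀ i := by
      refine LinearMap.ext fun v => ?_
      simp only [hEdef, LinearMap.sub_apply, LinearMap.add_apply, LinearMap.smulRight_apply, smul_add, sub_smul]
      abel
    rw [heq]
    exact Submodule.sub_mem _ (Submodule.add_mem _ hX (hoff i i₀ hi)) (hoff i₀ i (Ne.symm hi))
  -- expansion of `T`
  set c : Fin n → Fin n → ℂ := fun i j => b.coord i (T (b j)) with hcdef
  have hexp : T = ∑ i, ∑ j, c i j • E i j := UnitaryAdStable.eq_sum_matrixUnits b T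
  have htr : ∑ i, c i i = 0 := by rw [← hT, UnitaryAdStable.trace_eq_sum_coord b T]
  have hexp' : T = ∑ i, ∑ j, c i j • (E i j - if i = j then E i₀ i₀ else 0) := by
    have h : ∑ i, ∑ j, c i j • (E i j - if i = j then E i₀ i₀ else 0) =
        (∑ i, ∑ j, c i j • E i j) - (∑ i, c i i) • E i₀ i₀ := by
      simp only [smul_sub, Finset.sum_sub_distrib, smul_ite, smul_zero, Finset.sum_ite_eq, Finset.mem_univ, if_true,
        Finset.sum_smul]
    rw [h, htr, zero_smul, sub_zero]
    exact hexp
  rw [hexp']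
  refine Submodule.sum_mem _ fun i _ => Submodule.sum_mem _ fun j _ => Submodule.smul_mem _ _ ?_
  by_cases hij : i = j
  · rw [if_pos hij, ← hij]; exact hdiag i
  · rw [if_neg hij, sub_zero]; exact hoff i j hij

/-! ### §3 All of `End(V)` from one operator of non-zero trace -/

/-- **`𝔑 = End(V)`** as soon as the `ad`-stable `𝔑` (with a non-scalar element, `dim V ≥ 3`) contains an operator of
non-zero trace: `X = (X − (tr X / tr A₀)·A₀) + (tr X / tr A₀)·A₀`. [cite: Humphreys1972, §19.1] -/
theorem UnitaryAdStable.eq_top_of_trace_ne_zero [FiniteDimensional ℂ V] (𝔑 : Submodule ℂ (Module.End ℂ V))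
    (had : ∀ A : Module.End ℂ V, ∀ Y ∈ 𝔑, A * Y - Y * A ∈ 𝔑) {N : Module.End ℂ V} (hN : N ∈ 𝔑) {w : V}
    (hw : N w ∉ ℂ ∙ w) (h3 : 3 ≤ Module.finrank ℂ V) {A₀ : Module.End ℂ V} (hA₀ : A₀ ∈ 𝔑)
    (htr : LinearMap.trace ℂ V A₀ ≠ 0) : 𝔑 = ⊤ := by
  rw [eq_top_iff]
  intro X _
  set t : ℂ := LinearMap.trace ℂ V X / LinearMap.trace ℂ V A₀ with htdef
  have h0 : LinearMap.trace ℂ V (X - t • A₀) = 0 := by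
    rw [map_sub, map_smul, htdef, smul_eq_mul, div_mul_cancel₀ _ htr, sub_self]
  have hmem := UnitaryAdStable.mem_of_trace_eq_zero 𝔑 had hN hw h3 (X - t • A₀) h0
  have hX : X = (X - t • A₀) + t • A₀ := by abel
  rw [hX]
  exact Submodule.add_mem _ hmem (Submodule.smul_mem _ _ hA₀)

/-- **A rank-one idempotent in `𝔑`** under the hypotheses of `eq_top_of_trace_ne_zero` (`b₀ ⊗ b₀^*` for a basis).
[cite: Humphreys1972, §19.1] [cite: HoffmanKunze1971LinearAlgebra, §3.6] -/
theorem UnitaryAdStable.exists_rankOne_idempotent [FiniteDimensional ℂ V] (𝔑 : Submodule ℂ (Module.End ℂ V))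
    (had : ∀ A : Module.End ℂ V, ∀ Y ∈ 𝔑, A * Y - Y * A ∈ 𝔑) {N : Module.End ℂ V} (hN : N ∈ 𝔑) {w : V}
    (hw : N w ∉ ℂ ∙ w) (h3 : 3 ≤ Module.finrank ℂ V) {A₀ : Module.End ℂ V} (hA₀ : A₀ ∈ 𝔑)
    (htr : LinearMap.trace ℂ V A₀ ≠ 0) : ∃ (u : V) (φ : Module.Dual ℂ V), φ u = 1 ∧ φ.smulRight u ∈ 𝔑 := by
  have htop := UnitaryAdStable.eq_top_of_trace_ne_zero 𝔑 had hN hw h3 hA₀ htr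
  have hw0 : w ≠ 0 := fun h => hw (by rw [h, map_zero]; exact Submodule.zero_mem _)
  obtain ⟨φ, hφ⟩ := Module.Projective.exists_dual_eq_one ℂ hw0
  exact ⟨w, φ, hφ, htop ▸ Submodule.mem_top⟩

end HodgeStructure

end Literature.AlgebraicGeometry.Motives
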